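import Summits.NavierStokesRegularity.FluidComputer.PalasekTowerPerturbedDatumRun
import Summits.NavierStokesRegularity.FluidComputer.PalasekTowerPerturbedRunGradient
import Summits.NavierStokesRegularity.FluidComputer.PalasekTowerRegisterGlobalCoreFloors

/-!
# THE C¹ SHADOW of a bounded free run, circulation read-through, and the first hitting time of a floor

Cell `ns-blowup`, seat `ns-blowup-ecbridge-3` (g10; D-0074 GROUP C «BRIDGE SUPPORT», lineage
`host_preparation`; bears_on LADDER-NS N1, route `PalasekTowerBreakdown` rev 19, crux `EpisodeBaseT` =
item stmt-NavierStokesRegularity-20303, crux-strategist line «robustmirror», stub T2 `ShadowRegistersT`).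
LABEL: E–C typing + kernel analysis (theorems only; no definition, no named fact, no `sorry`).
WHAT THIS IS NOT: not Navier–Stokes evidence — continuous-dependence bookkeeping for GIVEN classical free
runs on a FIXED slab; no run, stage, design or blow-up is constructed or asserted.

## Contents (`ν = 1`, slab `[0, T] × ℝ³`)

* `FreeRun.exists_C1_shadow` — **THE C¹ SHADOW.** Let `(u, p)` be a classical finite-energy solution of the
  UNFORCED system on `[0, T]`, `‖u‖ ≤ M`. For every `δ > 0` and every accuracy `θ > 0` there is `ε > 0` such
  that every smooth divergence-free rapidly decaying datum `a` with `‖a − u(0)‖ ≤ ε` EVERYWHERE launches a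
  classical finite-energy free run `(v, q)` on the whole slab with `‖v − u‖ ≤ θ` on `[0, T] × ℝ³` AND
  `‖Dv − Du‖ ≤ θ` on `(δ, T) × ℝ³`. Ingredients, all in the tree: the perturbed-datum run
  (`PerturbedDatum.exists_free_run_near_of_datum`: mild bootstrap, C⁰ shadow `2ε e^{λt}`), KNSS (4.10) with
  constants first for BOTH runs (`exists_uniform_iteratedFDeriv_bound_of_bounded_classical`: `‖D²·‖ ≤ C 2 δ`
  on `(δ, T)` from boundedness and finite energy alone — NO hypothesis on `Da`), and Landau's inequality
  (`PerturbedRun.norm_fderiv_sub_le_final`).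
* `circulation_ge_of_near` — a floor `Γ + η ≤ ∮_γ u` survives as `Γ ≤ ∮_γ v` when `‖v − u‖ ≤ Φ` everywhere,
  `‖γ′‖ ≤ L` and `Φ L ≤ η` (`circulation_add_left`, `abs_circulation_le_of_speed_le`).
* `exists_isLeast_floorTime` — **the first hitting time of a floor in a ball exists**: for `v` jointly
  continuous on `[0, T] × ℝ³`, if the floor `Y ≤ ‖v t x‖` is met at some `t ∈ [0, T]`, `‖x‖ ≤ r₁`, then the
  set of such `t` has a LEAST element (projection of a compact set).

References: T. Tao, Anal. PDE 6 (2013) Thm. 5.4 [cite: Tao2011, Thm. 5.4 (ii)+(iv)]; G. Koch,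
N. Nadirashvili, G. Seregin, V. Šverák, Acta Math. 203 (2009) §4 (4.10)
[cite: KochNadirashviliSereginSverak2009, §4 (4.10)]; G. H. Hardy, J. E. Littlewood, G. Pólya,
*Inequalities* §8 [cite: HardyLittlewoodPolya1952, §8 (Landau's inequality)]; S. Palasek, arXiv:2605.13827
§3.3 [cite: Palasek2026ElementaryModel, §3.3].
-/

noncomputable section

namespace Summit.NavierStokesRegularity.FluidComputer.PalasekTowerClayBridge

open Set MeasureTheory Filter Topology Function Real
open scoped ENNReal NNReal ContDiff
open Literature.Analysis Literature.Analysis.FluidPDE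

/-! ## §1 The C¹ shadow of a bounded free run -/

namespace FreeRun

/-- **THE C¹ SHADOW OF A BOUNDED FREE RUN.** Let `(u, p)` be a classical solution of the unforced
Navier–Stokes system (`ν = 1`) on `[0, T] × ℝ³`, `T > 0`, with finite energy and `‖u‖ ≤ M` (`M > 0`). For
every `δ > 0` and `θ > 0` there is `ε > 0` such that: every smooth divergence-free rapidly decaying datum `a`
with `‖a(x) − u(0, x)‖ ≤ ε` for all `x` has a classical finite-energy free run `(v, q)` on `[0, T] × ℝ³`,
`v 0 = a`, with `‖v(t,x) − u(t,x)‖ ≤ θ` for `t ∈ [0, T]` and `‖Dv(t,x) − Du(t,x)‖ ≤ θ` for `t ∈ (δ, T)`.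
[cite: Tao2011, Thm. 5.4 (ii)+(iv)] [cite: KochNadirashviliSereginSverak2009, §4 (4.10)]
[cite: HardyLittlewoodPolya1952, §8 (Landau's inequality)] -/
theorem exists_C1_shadow {T M : ℝ} {u : ℝ → EuclideanSpace ℝ (Fin 3) → EuclideanSpace ℝ (Fin 3)}
    {p : ℝ → EuclideanSpace ℝ (Fin 3) → ℝ} (hT : 0 < T) (hu : IsClassicalNSSolutionOn (Icc 0 T) 1 0 u p)
    (hE : ∃ C : ℝ≥0∞, C < ⊤ ∧ ∀ t ∈ Icc 0 T, ∫⁻ x, ‖u t x‖ₑ ^ 2 ≤ C) (hM : 0 < M)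
    (hbd : ∀ t ∈ Icc 0 T, ∀ x, ‖u t x‖ ≤ M) {δ θ : ℝ} (hδ : 0 < δ) (hθ : 0 < θ) :
    ∃ ε : ℝ, 0 < ε ∧
      ∀ a : EuclideanSpace ℝ (Fin 3) → EuclideanSpace ℝ (Fin 3),
        ContDiff ℝ ∞ a → VectorCalculus.IsDivFree a → HasRapidSpatialDecay a →
        (∀ x, ‖a x - u 0 x‖ ≤ ε) →
        ∃ (v : ℝ → EuclideanSpace ℝ (Fin 3) → EuclideanSpace ℝ (Fin 3))
          (q : ℝ → EuclideanSpace ℝ (Fin 3) → ℝ),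
          IsClassicalNSSolutionOn (Icc 0 T) 1 0 v q ∧ v 0 = a ∧
          (∃ C : ℝ≥0∞, C < ⊤ ∧ ∀ t ∈ Icc 0 T, ∫⁻ x, ‖v t x‖ₑ ^ 2 ≤ C) ∧
          (∀ t ∈ Icc 0 T, ∀ x, ‖v t x - u t x‖ ≤ θ) ∧
          (∀ t ∈ Ioo δ T, ∀ x, ‖fderiv ℝ (v t) x - fderiv ℝ (u t) x‖ ≤ θ) := by
  -- ### constants: the Grönwall factor, the KNSS second-derivative bound, the Landau step
  set C₀ : ℝ := oseenSliceConst (EuclideanSpace ℝ (Fin 3)) with hC₀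
  set lam : ℝ := 36 * C₀ ^ 2 * (M + (M + 1)) ^ 2 / 1 with hlam_def
  have hlam0 : 0 ≤ lam := by positivity
  obtain ⟨C, hC⟩ := exists_uniform_iteratedFDeriv_bound_of_bounded_classical (M + 1) T hT
  set K : ℝ := |C 2 δ| + 1 with hK_def
  have hKpos : 0 < K := by positivity
  have hCK : C 2 δ ≤ K := (le_abs_self _).trans (by linarith)
  set h : ℝ := θ / (4 * K) with hh_def
  have hhpos : 0 < h := by positivity
  have hKh : (K + K) * h = θ / 2 := by
    rw [hh_def]; field_simp; ring
  set Φ : ℝ := min θ (min (θ * h / 4) (1 / 4)) with hΦ_def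
  have hΦpos : 0 < Φ := lt_min hθ (lt_min (by positivity) (by norm_num))
  have hΦθ : Φ ≤ θ := min_le_left _ _
  have hΦh : Φ ≤ θ * h / 4 := (min_le_right _ _).trans (min_le_left _ _)
  have hΦ4 : Φ ≤ 1 / 4 := (min_le_right _ _).trans (min_le_right _ _)
  set ε : ℝ := Φ / (2 * Real.exp (lam * T)) with hε_def
  have hεpos : 0 < ε := by positivity
  have h2ε : 2 * ε * Real.exp (lam * T) = Φ := by
    rw [hε_def]; field_simp
  refine ⟨ε, hεpos, fun a ha hadiv hadec haε => ?_⟩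
  -- ### THE PERTURBED-DATUM RUN
  have hsmall : 2 * ε * Real.exp (36 * oseenSliceConst (EuclideanSpace ℝ (Fin 3)) ^ 2 *
      (M + (M + 1)) ^ 2 / 1 * T) ≤ 1 / 2 := by
    rw [← hC₀, ← hlam_def, h2ε]; linarith
  obtain ⟨v, q, hv, hv0, hEv, hclose⟩ :=
    PerturbedDatum.exists_free_run_near_of_datum hT hu hE hM hbd hadec haε hsmall ha hadiv
  have hcloseΦ : ∀ t ∈ Icc 0 T, ∀ x, ‖v t x - u t x‖ ≤ Φ := by
    intro t ht x
    refine (hclose t ht x).trans ?_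
    have h1 : Real.exp (36 * oseenSliceConst (EuclideanSpace ℝ (Fin 3)) ^ 2 * (M + (M + 1)) ^ 2 / 1 * t) ≤
        Real.exp (lam * T) := by
      rw [← hC₀, ← hlam_def]
      exact Real.exp_le_exp.2 (mul_le_mul_of_nonneg_left ht.2 hlam0)
    calc 2 * ε * Real.exp (36 * oseenSliceConst (EuclideanSpace ℝ (Fin 3)) ^ 2 * (M + (M + 1)) ^ 2 / 1 * t)
        ≤ 2 * ε * Real.exp (lam * T) := mul_le_mul_of_nonneg_left h1 (by positivity)
      _ = Φ := h2ε
  -- ### sup bounds of both runs by `M + 1`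
  have hubd : ∀ t ∈ Icc 0 T, ∀ x, ‖u t x‖ ≤ M + 1 := fun t ht x => (hbd t ht x).trans (by linarith)
  have hvbd : ∀ t ∈ Icc 0 T, ∀ x, ‖v t x‖ ≤ M + 1 := by
    intro t ht x
    have h1 := hcloseΦ t ht x
    have h2 := hbd t ht x
    calc ‖v t x‖ = ‖u t x + (v t x - u t x)‖ := by rw [add_sub_cancel]
      _ ≤ ‖u t x‖ + ‖v t x - u t x‖ := norm_add_le _ _
      _ ≤ M + 1 := by linarith
  have hM1 : 0 < M + 1 := by linarith
  -- ### KNSS (4.10): second derivatives of BOTH runs on `(δ, T)`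
  have hD2u : ∀ t ∈ Ioo δ T, ∀ x, ‖iteratedFDeriv ℝ 2 (u t) x‖ ≤ K := fun t ht x =>
    (hC hu hE hM1 hubd δ hδ 2 t ht x).trans hCK
  have hD2v : ∀ t ∈ Ioo δ T, ∀ x, ‖iteratedFDeriv ℝ 2 (v t) x‖ ≤ K := fun t ht x =>
    (hC hv hEv hM1 hvbd δ hδ 2 t ht x).trans hCK
  refine ⟨v, q, hv, hv0, hEv, fun t ht x => (hcloseΦ t ht x).trans hΦθ, fun t ht x => ?_⟩
  -- ### Landau: gradient closeness on `(δ, T)`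
  have ht' : t ∈ Icc 0 T := ⟨(hδ.trans ht.1).le, ht.2.le⟩
  have h2u : ContDiff ℝ 2 (u t) := (hu.contDiff_velocity ht').of_le (by norm_cast)
  have h2v : ContDiff ℝ 2 (v t) := (hv.contDiff_velocity ht').of_le (by norm_cast)
  have hL := PerturbedRun.norm_fderiv_sub_le_final (T := t) (Φ := Φ) (K := K) (Ku := K) (h := h)
    (u := u) (u' := v) h2u h2v (fun x => hcloseΦ t ht' x) (hD2v t ht) (hD2u t ht) hhpos x
  have herr : 2 * Φ / h + (K + K) * h ≤ θ := by
    rw [hKh]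
    have h1 : 2 * Φ / h ≤ θ / 2 := by
      rw [div_le_iff₀ hhpos]
      linarith
    linarith
  exact hL.trans herr

end FreeRun

/-! ## §2 Reading a circulation floor through a sup-perturbation -/

/-- **A circulation floor survives a small sup-perturbation of the field**: if `u`, `v` are continuous with
`‖v − u‖ ≤ Φ` everywhere, `γ` is a `C¹` curve of speed `≤ L` on `[0, 1]`, `Φ L ≤ η` and
`Γ + η ≤ ∮_γ u · dℓ`, then `Γ ≤ ∮_γ v · dℓ`. [cite: MajdaBertozziCUP2002, §1.6 eq. (1.57)] -/
theorem circulation_ge_of_near {u v : EuclideanSpace ℝ (Fin 3) → EuclideanSpace ℝ (Fin 3)}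
    {γ : ℝ → EuclideanSpace ℝ (Fin 3)} (hu : Continuous u) (hv : Continuous v) (hγ : ContDiff ℝ 1 γ)
    {Φ L η Γ : ℝ} (hclose : ∀ x, ‖v x - u x‖ ≤ Φ) (hL : ∀ s ∈ Icc (0 : ℝ) 1, ‖deriv γ s‖ ≤ L)
    (hΦL : Φ * L ≤ η) (hΓ : Γ + η ≤ circulation u γ) : Γ ≤ circulation v γ := by
  have hsplit : circulation v γ = circulation u γ + circulation (v - u) γ := by
    have := circulation_add_left hu (hv.sub hu) hγ (v := u) (w := v - u)
    rw [← this, add_sub_cancel]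
  have hsmall : |circulation (v - u) γ| ≤ Φ * L :=
    abs_circulation_le_of_speed_le (fun s _ => by simpa using hclose (γ s)) hL
  have h1 := (abs_le.1 hsmall).1
  rw [hsplit]
  linarith

/-! ## §3 The first hitting time of a floor in a ball -/

/-- **The first time a floor is met inside a ball exists.** If `v` is jointly continuous on `[0, T] × ℝ³`
and the floor `Y ≤ ‖v t x‖` is met at some `t ∈ [0, T]` and some `‖x‖ ≤ r₁`, then the set of such times
has a least element (it is the projection of a compact subset of `[0, T] × B̄(0, r₁)`). [folklore] -/
theorem exists_isLeast_floorTime {v : ℝ → EuclideanSpace ℝ (Fin 3) → EuclideanSpace ℝ (Fin 3)}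
    {T r₁ Y : ℝ} (hcont : ContinuousOn (uncurry v) (Icc 0 T ×ˢ univ))
    (hne : ∃ t ∈ Icc 0 T, ∃ x : EuclideanSpace ℝ (Fin 3), ‖x‖ ≤ r₁ ∧ Y ≤ ‖v t x‖) :
    ∃ t₀, IsLeast {t | t ∈ Icc 0 T ∧ ∃ x : EuclideanSpace ℝ (Fin 3), ‖x‖ ≤ r₁ ∧ Y ≤ ‖v t x‖} t₀ := by
  set K : Set (ℝ × EuclideanSpace ℝ (Fin 3)) := Icc 0 T ×ˢ Metric.closedBall 0 r₁ with hK_def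
  have hKc : IsCompact K := isCompact_Icc.prod (isCompact_closedBall _ _)
  have hKcl : IsClosed K := isClosed_Icc.prod Metric.isClosed_closedBall
  have hKsub : K ⊆ Icc 0 T ×ˢ univ := prod_mono le_rfl (subset_univ _)
  have hg : ContinuousOn (fun z => ‖uncurry v z‖) K := (hcont.mono hKsub).norm
  set F : Set (ℝ × EuclideanSpace ℝ (Fin 3)) := K ∩ (fun z => ‖uncurry v z‖) ⁻¹' Ici Y with hF_def
  have hFcl : IsClosed F := hg.preimage_isClosed_of_isClosed hKcl isClosed_Ici
  have hFc : IsCompact F := hKc.of_isClosed_subset hFcl inter_subset_left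
  have hHc : IsCompact (Prod.fst '' F) := hFc.image continuous_fst
  have hHeq : Prod.fst '' F = {t | t ∈ Icc 0 T ∧ ∃ x : EuclideanSpace ℝ (Fin 3), ‖x‖ ≤ r₁ ∧ Y ≤ ‖v t x‖} := by
    ext t
    simp only [mem_image, mem_setOf_eq, hF_def, hK_def, mem_inter_iff, mem_prod, Metric.mem_closedBall,
      dist_zero_right, mem_preimage, mem_Ici, Prod.exists, uncurry_apply_pair]
    constructor
    · rintro ⟨t', x, ⟨⟨ht', hx⟩, hY⟩, rfl⟩
      exact ⟨ht', x, hx, hY⟩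
    · rintro ⟨ht, x, hx, hY⟩
      exact ⟨t, x, ⟨⟨ht, hx⟩, hY⟩, rfl⟩
  obtain ⟨t, ht, x, hx, hY⟩ := hne
  have hHne : (Prod.fst '' F).Nonempty := ⟨t, (t, x), ⟨⟨ht, by simpa using hx⟩, hY⟩, rfl⟩
  obtain ⟨t₀, ht₀⟩ := hHc.exists_isLeast hHne
  exact ⟨t₀, hHeq ▸ ht₀⟩

end Summit.NavierStokesRegularity.FluidComputer.PalasekTowerClayBridge

end
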